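import Mathlib
import Summits.KontsevichZagierPeriods.KontsevichZagierPeriods.Theorems.InverseLandauTateLiftingTranscSector
import Summits.KontsevichZagierPeriods.KontsevichZagierPeriods.Theorems.InverseLandauTateLiftingLogIntegral
import Literature.Barriers.Schanuel.AlgebraicIndependenceOfLogarithmsProofs

/-!
# `TateLifting` (stmt-KontsevichZagierPeriods-9129), line `Sketch` — the transcendence sector: singletons,
# Hermite–Lindemann and the `ℚ̄`-line of a logarithm

Companion to `Theorems/InverseLandauTateLiftingTranscSector.lean` (lead c6). The transfer
`transcRingKernel` needs only the VALUES of the adjoined classes; for a single class it reads: if the value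
of a representation `r` (any dimension, any shape) is transcendental, then `evalP` is injective on
`K₀[⟦r⟧]` (`transcSingletonRingKernel`) — every polynomial with real-algebraic coefficients annihilated by
`value r` inside the calculus is already a relation. With the tree's proved Hermite–Lindemann theorem
(`transcendental_exp_holds`, read as `Literature.Barriers.Schanuel.transcendental_of_isAlgebraic_cexp`):
`log α` is transcendental for real algebraic `α > 0`, `α ≠ 1` (`Transc.transcendental_log_of_isAlgebraic`),
hence (`logSectorRingKernel`) **for every representation `r` of `log α` the ring `ℚ̄[⟦r⟧]` is a sector of
Conjecture 1 — unconditionally**; the pair form `equivalent_of_mem_logSector`, and the instance for the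
line's own unfolded logarithm `[(0,1), (α−1) dz/(1+(α−1)z)]` (`tateLifting_logIntegral`, lead c0):
`logSectorRingKernel_unfolded`. (The weight-one sector of leads c0/c1 handles LINEAR forms in several
logarithms via Baker; polynomial identities in two or more logarithms are the open algebraic independence of
logarithms, `Literature.Barriers.Schanuel.AlgIndepLogarithms`.)

References: M. Kontsevich, D. Zagier, *Periods* (2001), §1.2; A. Baker, *Transcendental Number Theory*
(1975), Ch. 1 §3 (Hermite–Lindemann).
-/

noncomputable section

open MeasureTheory Set
open Literature.NumberTheory.Transcendental

namespace Summit.KontsevichZagierPeriods.InverseLandau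

namespace Transc

/-- The values of a singleton family `![⟦r⟧]`. [folklore] -/
theorem evalP_vecSingleton {n : ℕ} (r : KZ.IntegralRep n) :
    (fun i : Fin 1 => KZ.evalP ((![KZ.toFormalPeriod (KZ.of r)] : Fin 1 → KZ.FormalPeriodRing) i)) =
      ![r.value] := by
  funext i
  fin_cases i
  simp

/-- **Hermite–Lindemann for real logarithms**: `log α` is transcendental for a real algebraic `α > 0`,
`α ≠ 1` (`e^{log α} = α` is algebraic and `log α ≠ 0`; tree theorem `transcendental_exp_holds` through
`Literature.Barriers.Schanuel.transcendental_of_isAlgebraic_cexp`).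
[cite: BakerTNT1975, Ch. 1 §3, corollaries of Theorem 1.4, p. 6] -/
theorem transcendental_log_of_isAlgebraic {α : ℝ} (hα : IsAlgebraic ℚ α) (h0 : 0 < α) (h1 : α ≠ 1) :
    Transcendental ℚ (Real.log α) := by
  have hne : ((Real.log α : ℝ) : ℂ) ≠ 0 := by
    exact_mod_cast Real.log_ne_zero_of_pos_of_ne_one h0 h1
  have hexp : IsAlgebraic ℚ (Complex.exp (Real.log α : ℂ)) := by
    rw [← Complex.ofReal_exp, Real.exp_log h0]
    exact hα.algebraMap
  have hC := Literature.Barriers.Schanuel.transcendental_of_isAlgebraic_cexp hexp hne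
  exact (transcendental_algebraMap_iff (R := ℚ) (A := ℂ) Complex.ofReal_injective).mp hC

end Transc

/-- **Singleton transfer**: if the value of a representation `r` is transcendental, `evalP` is injective
on the subring `K₀[⟦r⟧]` generated by the dimension-zero classes and `⟦r⟧`.
[cite: KontsevichZagier2001, §1.2] -/
theorem transcSingletonRingKernel {n : ℕ} (r : KZ.IntegralRep n) (ht : Transcendental ℚ r.value) :
    ∀ y ∈ Subring.closure
        (Set.range (fun b : KZ.IntegralRep 0 => KZ.toFormalPeriod (KZ.of b)) ∪
          Set.range (![KZ.toFormalPeriod (KZ.of r)] : Fin 1 → KZ.FormalPeriodRing)),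
      KZ.evalP y = 0 → y = 0 :=
  transcRingKernel _ (by
    rw [Transc.evalP_vecSingleton]
    exact algebraicIndependent_iff_transcendental.2 ht)

/-- **THE `ℚ̄`-LINE OF A LOGARITHM — UNCONDITIONAL (Hermite–Lindemann in `P`).** For a real algebraic
`α > 0`, `α ≠ 1` and ANY integral representation `r` of `log α`, `evalP` is injective on `K₀[⟦r⟧]`: every
polynomial identity with real-algebraic coefficients satisfied by `log α` is derivable by the moves (there is
none). [cite: BakerTNT1975, Ch. 1 §3, corollaries of Theorem 1.4, p. 6] -/
theorem logSectorRingKernel {α : ℝ} (hα : IsAlgebraic ℚ α) (h0 : 0 < α) (h1 : α ≠ 1) {n : ℕ}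
    (r : KZ.IntegralRep n) (hr : r.value = Real.log α) :
    ∀ y ∈ Subring.closure
        (Set.range (fun b : KZ.IntegralRep 0 => KZ.toFormalPeriod (KZ.of b)) ∪
          Set.range (![KZ.toFormalPeriod (KZ.of r)] : Fin 1 → KZ.FormalPeriodRing)),
      KZ.evalP y = 0 → y = 0 :=
  transcSingletonRingKernel r (hr ▸ Transc.transcendental_log_of_isAlgebraic hα h0 h1)

/-- **Conjecture 1 (kernel form) on the `ℚ̄`-line of a logarithm, for formal combinations.**
[cite: KontsevichZagier2001, §1.2] -/
theorem mem_relations_of_mem_logSector {α : ℝ} (hα : IsAlgebraic ℚ α) (h0 : 0 < α) (h1 : α ≠ 1)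
    {n : ℕ} (r : KZ.IntegralRep n) (hr : r.value = Real.log α) (c : KZ.FormalRep)
    (hc : KZ.toFormalPeriod c ∈ Subring.closure
        (Set.range (fun b : KZ.IntegralRep 0 => KZ.toFormalPeriod (KZ.of b)) ∪
          Set.range (![KZ.toFormalPeriod (KZ.of r)] : Fin 1 → KZ.FormalPeriodRing)))
    (h0c : KZ.eval c = 0) : c ∈ KZ.relations :=
  KZ.toFormalPeriod_eq_zero_iff.1
    (logSectorRingKernel hα h0 h1 r hr _ hc (by rw [KZ.evalP_toFormalPeriod, h0c]))

/-- **Equal values ⇒ KZ-equivalent on the `ℚ̄`-line of a logarithm.** [cite: KontsevichZagier2001, §1.2] -/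
theorem equivalent_of_mem_logSector {α : ℝ} (hα : IsAlgebraic ℚ α) (h0 : 0 < α) (h1 : α ≠ 1)
    {n : ℕ} (r : KZ.IntegralRep n) (hr : r.value = Real.log α) {k m : ℕ} (s : KZ.IntegralRep k)
    (s' : KZ.IntegralRep m)
    (hs : KZ.toFormalPeriod (KZ.of s) ∈ Subring.closure
        (Set.range (fun b : KZ.IntegralRep 0 => KZ.toFormalPeriod (KZ.of b)) ∪
          Set.range (![KZ.toFormalPeriod (KZ.of r)] : Fin 1 → KZ.FormalPeriodRing)))
    (hs' : KZ.toFormalPeriod (KZ.of s') ∈ Subring.closure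
        (Set.range (fun b : KZ.IntegralRep 0 => KZ.toFormalPeriod (KZ.of b)) ∪
          Set.range (![KZ.toFormalPeriod (KZ.of r)] : Fin 1 → KZ.FormalPeriodRing)))
    (hv : s.value = s'.value) : KZ.Equivalent s s' :=
  mem_relations_of_mem_logSector hα h0 h1 r hr (KZ.of s - KZ.of s')
    (by rw [map_sub]; exact Subring.sub_mem _ hs hs') (by rw [map_sub, KZ.eval_of, KZ.eval_of, hv, sub_self])

/-- **Instance: the unfolded logarithm of the line.** For a real algebraic `α > 0`, `α ≠ 1` and every
representation `L` with domain the open unit cube of `ℝ¹` and integrand `(α−1)/(1+(α−1)z₀)` on it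
(value `log α`, `tateLifting_logIntegral`), `evalP` is injective on `K₀[⟦L⟧]`.
[cite: BakerTNT1975, Ch. 1 §3, corollaries of Theorem 1.4, p. 6] -/
theorem logSectorRingKernel_unfolded {α : ℝ} (hα : IsAlgebraic ℚ α) (h0 : 0 < α) (h1 : α ≠ 1)
    (L : KZ.IntegralRep 1) (hLd : L.domain = Set.pi Set.univ (fun _ : Fin 1 => Set.Ioo (0 : ℝ) 1))
    (hLi : Set.EqOn L.integrand (fun z => (α - 1) / (1 + (α - 1) * z 0)) L.domain) :
    ∀ y ∈ Subring.closure
        (Set.range (fun b : KZ.IntegralRep 0 => KZ.toFormalPeriod (KZ.of b)) ∪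
          Set.range (![KZ.toFormalPeriod (KZ.of L)] : Fin 1 → KZ.FormalPeriodRing)),
      KZ.evalP y = 0 → y = 0 := by
  refine logSectorRingKernel hα h0 h1 L ?_
  unfold KZ.IntegralRep.value
  rw [setIntegral_congr_fun (KZ.IntegralRep.measurableSet_domain_holds L) hLi, hLd]
  exact tateLifting_logIntegral α h0

/-- **The unfolded-logarithm sector, closed form** (binder-free statement of `logSectorRingKernel_unfolded`,
the registered assembly theorem of this file). [cite: BakerTNT1975, Ch. 1 §3, corollaries of Theorem 1.4, p. 6] -/
theorem tateLifting_logSector :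
    ∀ (α : ℝ), IsAlgebraic ℚ α → 0 < α → α ≠ 1 → ∀ (L : KZ.IntegralRep 1),
      L.domain = Set.pi Set.univ (fun _ : Fin 1 => Set.Ioo (0 : ℝ) 1) →
      Set.EqOn L.integrand (fun z => (α - 1) / (1 + (α - 1) * z 0)) L.domain →
      ∀ y ∈ Subring.closure
          (Set.range (fun b : KZ.IntegralRep 0 => KZ.toFormalPeriod (KZ.of b)) ∪
            Set.range (![KZ.toFormalPeriod (KZ.of L)] : Fin 1 → KZ.FormalPeriodRing)),
        KZ.evalP y = 0 → y = 0 :=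
  fun _ hα h0 h1 L hLd hLi => logSectorRingKernel_unfolded hα h0 h1 L hLd hLi

end Summit.KontsevichZagierPeriods.InverseLandau

end
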